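/-
Copyright (c) 2026. All rights reserved.
Released under Apache 2.0 license as described in the file LICENSE.
Authors: abc-iut cell, prover seat abc-iut-w4-d072 (wave 4).
-/
import Literature.IUT.LogVolume.PacketDifferent
import HarnessLib

/-!
# The exponent `d_{I*}` of [IUTchIV] Prop. 1.1 is SHARP (equal-factor packets)

Mochizuki, *Inter-universal Teichmüller theory IV*, RIMS manuscript (Apr. 2020), §1, Proposition 1.1,
kurims p. 9: `p^{d_{I*}}·(R_I)^∼ ⊆ R_I ⊆ (R_I)^∼` (`prop11_holds`, abc-iut-S5, `PacketDifferent.lean`).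
This PROOF-ONLY file adds the converse bound for packets all of whose factors are ONE field `K/ℚ_p`
(the case of the capsules `⊗_{|I|} K_v`): **no smaller power works** —

* `norm_prod_mul_pow_le_one_of_smul_normalizedPacket_subset`: if a pure tensor `⊗_i x_i` multiplies
  `(R_I)^∼` into `R_I`, then `‖(∏_i x_i) · c^{|I|-1}‖ ≤ 1` for EVERY `c ∈ K` in the trace dual of
  `𝒪_K` (`Tr_{K/ℚ_p}(c·𝒪_K) ⊆ ℤ_p`);
* `prod_norm_le_of_smul_normalizedPacket_subset`: hence, for a generator `δ` of the different `𝔇_{K/ℚ_p}`,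
  `∏_i ‖x_i‖ ≤ ‖δ‖^{|I|-1} = p^{-(|I|-1)·d_K}`, i.e. `Σ_i ord(x_i) ≥ (|I|-1)·d_K = d_{I*}` — exactly the
  exponent at which Prop. 1.1 (`purePacket_mul_mem_integerPacket`) gives the inclusion.

Proof (classical): let `b` be a `ℚ_p`-basis of `K` and `d` its trace-dual basis.  For `i ≠ *` put
`E_i := Σ_m ι_*(d_m)·ι_i(b_m) ∈ V` and `e := ∏_{i≠*} E_i` (the idempotent cutting out the "diagonal"
factor `K` of `V = ⊗_{ℚ_p} K`): `ι_i(a)·E_i = ι_*(a)·E_i`, `E_i² = E_i` (from `Σ_m d_m b_m = 1`), so `e`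
is idempotent, hence integral, hence `e ∈ (R_I)^∼`; and `Tr_{V/k_*}(e · ⊗_i w_i) = ∏_i w_i` (induction on
the factors, using `Tr_{V/k_*}(⊗ z_i) = z_*·∏_{i≠*} Tr(z_i)`, `relTrace_purePacket`).  On the other hand
the functional `y ↦ Tr_{V/k_*}((1 ⊗ ⊗_{i≠*} c)·y)` maps `R_I` into `𝒪_K` when `Tr(c·𝒪_K) ⊆ ℤ_p`.
Applying it to `y = (⊗ x_i)·e ∈ R_I` gives `(∏_i x_i)·c^{|I|-1} ∈ 𝒪_K`.

Classical multilinear algebra over the cell's REAL definitions (`PacketAlgebra`, `integerPacket`,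
`normalizedPacket`, `purePacket`, `iota`, `different`, `differentOrd`); theorems only, no definitions, no
named `Prop` facts; nothing here takes a side on [IUTchIII] Cor. 3.12 (the tags record the cell's typing
of [IUTchIV]). [cite: Mochizuki2012, IUTchIV Prop. 1.1 p. 9]
-/

noncomputable section

open Metric Set Function Module
open scoped Pointwise TensorProduct NormedField nonZeroDivisors

namespace Literature.IUT.LogVolume

/-! ## Dual pairs of bases of `K/ℚ_p` for the trace form -/

section DualPair

variable {p : ℕ} [Fact p.Prime]
variable {K : Type} [NontriviallyNormedField K] [NormedAlgebra ℚ_[p] K]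
variable {κ : Type} [Fintype κ] [DecidableEq κ] (b d : Basis κ ℚ_[p] K)
  (hbd : ∀ i j, Algebra.trace ℚ_[p] K (d i * b j) = if j = i then 1 else 0)
include hbd

/-- Coordinates in the dual basis: `d.repr v i = Tr(v·b_i)`. [claim: Mochizuki2012, status: disputed] -/
theorem dualPair_repr_right (v : K) (i : κ) : d.repr v i = Algebra.trace ℚ_[p] K (v * b i) := by
  classical
  conv_rhs => rw [← d.sum_repr v]
  rw [Finset.sum_mul, map_sum]
  simp_rw [smul_mul_assoc, LinearMap.map_smul, hbd, smul_eq_mul, mul_ite, mul_one, mul_zero]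
  rw [Finset.sum_ite_eq Finset.univ i, if_pos (Finset.mem_univ i)]

/-- Coordinates in the basis: `b.repr v i = Tr(v·d_i)`. [claim: Mochizuki2012, status: disputed] -/
theorem dualPair_repr_left (v : K) (i : κ) : b.repr v i = Algebra.trace ℚ_[p] K (v * d i) := by
  classical
  conv_rhs => rw [← b.sum_repr v]
  rw [Finset.sum_mul, map_sum]
  have h : ∀ j, Algebra.trace ℚ_[p] K (b.repr v j • b j * d i) = if i = j then b.repr v j else 0 := by
    intro j
    rw [smul_mul_assoc, LinearMap.map_smul, mul_comm, hbd, smul_eq_mul, mul_ite, mul_one, mul_zero]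
    by_cases hij : i = j
    · subst hij; simp
    · rw [if_neg (Ne.symm hij), if_neg hij]
  simp_rw [h]
  rw [Finset.sum_ite_eq Finset.univ i, if_pos (Finset.mem_univ i)]

/-- Expansion in the dual basis: `v = Σ_m Tr(v·b_m)·d_m`. [claim: Mochizuki2012, status: disputed] -/
theorem dualPair_sum_trace_mul_smul (v : K) :
    ∑ m, Algebra.trace ℚ_[p] K (v * b m) • d m = v := by
  conv_rhs => rw [← d.sum_repr v]
  exact Finset.sum_congr rfl fun m _ => by rw [dualPair_repr_right b d hbd]

/-- Expansion in the basis: `v = Σ_m Tr(v·d_m)·b_m`. [claim: Mochizuki2012, status: disputed] -/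
theorem dualPair_sum_trace_mul_smul' (v : K) :
    ∑ m, Algebra.trace ℚ_[p] K (v * d m) • b m = v := by
  conv_rhs => rw [← b.sum_repr v]
  exact Finset.sum_congr rfl fun m _ => by rw [dualPair_repr_left b d hbd]

/-- **`Σ_m d_m·b_m = 1`** (pair both sides with an arbitrary `w` under the non-degenerate trace form:
`Tr(w·Σ d_m b_m) = Σ_m [b-coordinate m of w·b_m] = Tr(w)`). [claim: Mochizuki2012, status: disputed] -/
theorem dualPair_sum_mul_eq_one [IsUltrametricDist K] [ProperSpace K] : ∑ m, d m * b m = 1 := by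
  classical
  haveI := finiteDimensional p K
  have key : ∀ w : K, Algebra.trace ℚ_[p] K (w * ∑ m, d m * b m) = Algebra.trace ℚ_[p] K w := by
    intro w
    rw [Finset.mul_sum, map_sum, Algebra.trace_eq_matrix_trace b w, Matrix.trace]
    refine Finset.sum_congr rfl fun m _ => ?_
    rw [Matrix.diag_apply, Algebra.leftMulMatrix_eq_repr_mul, dualPair_repr_left b d hbd]
    ring_nf
  have hnd := traceForm_nondegenerate ℚ_[p] K
  have h0 : (∑ m, d m * b m) - 1 = 0 := by
    refine hnd.1 _ fun w => ?_
    rw [Algebra.traceForm_apply, sub_mul, map_sub, one_mul, mul_comm, key, sub_self]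
  exact sub_eq_zero.mp h0

end DualPair

/-! ## The diagonal idempotent of an equal-factor packet and its relative trace -/

section Diagonal

variable (p : ℕ) [Fact p.Prime]
variable {I : Type} [Fintype I] [DecidableEq I]
variable (K : Type) [NontriviallyNormedField K] [NormedAlgebra ℚ_[p] K] [IsUltrametricDist K]
  [ProperSpace K]
variable (star : I) [Algebra K (PacketAlgebra p (fun _ : I => K))]
  (hV : ∀ a : K, algebraMap K (PacketAlgebra p (fun _ : I => K)) a = iota p (fun _ : I => K) star a)
variable {κ : Type} [Fintype κ] [DecidableEq κ] (b d : Basis κ ℚ_[p] K)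
  (hbd : ∀ i j, Algebra.trace ℚ_[p] K (d i * b j) = if j = i then 1 else 0)

include hV in
omit [Fintype I] [IsUltrametricDist K] [ProperSpace K] in
/-- `ι_*(a)·y = a • y` for the `k_*`-structure through `ι_*`. [claim: Mochizuki2012, status: disputed] -/
theorem iota_star_mul_eq_smul (a : K) (y : PacketAlgebra p (fun _ : I => K)) :
    iota p (fun _ : I => K) star a * y = a • y := by
  rw [Algebra.smul_def, hV]

include hbd in
omit [Fintype I] [IsUltrametricDist K] [ProperSpace K] [Algebra K (PacketAlgebra p (fun _ : I => K))] in
/-- **Slot swap on `E_i := Σ_m ι_*(d_m)·ι_i(b_m)`**: `ι_i(a)·E_i = ι_*(a)·E_i`.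
[claim: Mochizuki2012, status: disputed] -/
theorem iota_mul_diagE (i : I) (a : K) :
    iota p (fun _ : I => K) i a * ∑ m, iota p (fun _ : I => K) star (d m) * iota p (fun _ : I => K) i (b m) =
      iota p (fun _ : I => K) star a *
        ∑ m, iota p (fun _ : I => K) star (d m) * iota p (fun _ : I => K) i (b m) := by
  -- left: move `ι_i(a)` into the `i`-slot and expand `a·b_m` in the basis `b`
  have hL : iota p (fun _ : I => K) i a *
        ∑ m, iota p (fun _ : I => K) star (d m) * iota p (fun _ : I => K) i (b m) =
      ∑ m, ∑ m', Algebra.trace ℚ_[p] K (a * b m * d m') •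
        (iota p (fun _ : I => K) star (d m) * iota p (fun _ : I => K) i (b m')) := by
    rw [Finset.mul_sum]
    refine Finset.sum_congr rfl fun m _ => ?_
    rw [mul_left_comm, ← map_mul]
    conv_lhs => rw [← dualPair_sum_trace_mul_smul' b d hbd (a * b m)]
    rw [map_sum, Finset.mul_sum]
    refine Finset.sum_congr rfl fun m' _ => ?_
    rw [map_smul, mul_smul_comm]
  -- right: expand `a·d_{m'}` in the dual basis `d`
  have hR : iota p (fun _ : I => K) star a *
        ∑ m', iota p (fun _ : I => K) star (d m') * iota p (fun _ : I => K) i (b m') =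
      ∑ m', ∑ m, Algebra.trace ℚ_[p] K (a * d m' * b m) •
        (iota p (fun _ : I => K) star (d m) * iota p (fun _ : I => K) i (b m')) := by
    rw [Finset.mul_sum]
    refine Finset.sum_congr rfl fun m' _ => ?_
    rw [← mul_assoc, ← map_mul]
    conv_lhs => rw [← dualPair_sum_trace_mul_smul b d hbd (a * d m')]
    rw [map_sum, Finset.sum_mul]
    refine Finset.sum_congr rfl fun m _ => ?_
    rw [map_smul, smul_mul_assoc]
  rw [hL, hR, Finset.sum_comm]
  refine Finset.sum_congr rfl fun m' _ => Finset.sum_congr rfl fun m _ => ?_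
  congr 2
  ring

include hbd in
omit [Fintype I] [Algebra K (PacketAlgebra p (fun _ : I => K))] in
/-- **`E_i` is idempotent** (`E_i² = ι_*(Σ_m d_m b_m)·E_i = E_i`). [claim: Mochizuki2012, status: disputed] -/
theorem isIdempotentElem_diagE (i : I) :
    IsIdempotentElem (∑ m, iota p (fun _ : I => K) star (d m) * iota p (fun _ : I => K) i (b m)) := by
  have hswap := fun a => iota_mul_diagE p K star b d hbd i a
  unfold IsIdempotentElem
  rw [Finset.sum_mul]
  conv_lhs => arg 2; ext m; rw [mul_assoc, hswap (b m), ← mul_assoc, ← map_mul]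
  rw [← Finset.sum_mul, ← map_sum, dualPair_sum_mul_eq_one b d hbd, map_one, one_mul]

include hbd in
omit [Fintype I] [Algebra K (PacketAlgebra p (fun _ : I => K))] in
/-- The product `e := ∏_{i ∈ s} E_i` is idempotent. [claim: Mochizuki2012, status: disputed] -/
theorem isIdempotentElem_prod_diagE (s : Finset I) :
    IsIdempotentElem (∏ i ∈ s, ∑ m, iota p (fun _ : I => K) star (d m) * iota p (fun _ : I => K) i (b m)) := by
  induction s using Finset.induction_on with
  | empty => rw [Finset.prod_empty]; exact IsIdempotentElem.one
  | insert a s ha ih =>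
    rw [Finset.prod_insert ha]
    exact (isIdempotentElem_diagE p K star b d hbd a).mul ih

omit [Fintype I] [DecidableEq I] [IsUltrametricDist K] [ProperSpace K]
  [Algebra K (PacketAlgebra p (fun _ : I => K))] in
/-- An idempotent of `V` lies in `(R_I)^∼` (it is a root of `X² − X`). [claim: Mochizuki2012, status: disputed] -/
theorem mem_normalizedPacket_of_isIdempotentElem [Nonempty I] {e : PacketAlgebra p (fun _ : I => K)}
    (he : IsIdempotentElem e) : e ∈ normalizedPacket p (fun _ : I => K) := by
  refine mem_normalizedPacket_of_isIntegral p (fun _ : I => K) ?_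
  refine ⟨Polynomial.X ^ 2 - Polynomial.X, ?_, ?_⟩
  · exact (Polynomial.monic_X_pow 2).sub_of_left
      (by rw [Polynomial.degree_X_pow, Polynomial.degree_X]; norm_num)
  · simp [sq, he.eq]

include hV hbd in
/-- **Relative trace against the partial diagonal idempotents**: for `s ⊆ I ∖ {*}` and any `w`,
`Tr_{V/k_*}((∏_{i∈s} E_i)·⊗_i w_i) = w_* · ∏_{i∈s} w_i · ∏_{i ∉ s, i ≠ *} Tr_{K/ℚ_p}(w_i)`.
[claim: Mochizuki2012, status: disputed] -/
theorem relTrace_prod_diagE_mul_purePacket (s : Finset I) :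
    s ⊆ Finset.univ.erase star → ∀ w : I → K,
    Algebra.trace K (PacketAlgebra p (fun _ : I => K))
        ((∏ i ∈ s, ∑ m, iota p (fun _ : I => K) star (d m) * iota p (fun _ : I => K) i (b m)) *
          purePacket p (fun _ : I => K) w) =
      w star * (∏ i ∈ s, w i) *
        algebraMap ℚ_[p] K (∏ i ∈ (Finset.univ.erase star) \ s, Algebra.trace ℚ_[p] K (w i)) := by
  induction s using Finset.induction_on with
  | empty =>
    intro _ w
    rw [Finset.prod_empty, one_mul, Finset.prod_empty, mul_one, Finset.sdiff_empty,
      relTrace_purePacket p (fun _ : I => K) star hV w]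
  | insert a s ha ih =>
    intro hs w
    have haE : a ∈ Finset.univ.erase star := hs (Finset.mem_insert_self a s)
    have hastar : a ≠ star := Finset.ne_of_mem_erase haE
    have hs' : s ⊆ Finset.univ.erase star := fun i hi => hs (Finset.mem_insert_of_mem hi)
    set P := ∏ i ∈ s, ∑ m, iota p (fun _ : I => K) star (d m) * iota p (fun _ : I => K) i (b m) with hP
    set R := ∏ i ∈ (Finset.univ.erase star) \ insert a s, Algebra.trace ℚ_[p] K (w i) with hR
    rw [Finset.prod_insert ha]
    -- `(E_a · P)·⊗w = Σ_m d_m • (P · ⊗ w^{(m)})`, `w^{(m)} := w` with `b_m w_a` in slot `a`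
    have hexp : (∑ m, iota p (fun _ : I => K) star (d m) * iota p (fun _ : I => K) a (b m)) * P *
          purePacket p (fun _ : I => K) w =
        ∑ m, d m • (P * purePacket p (fun _ : I => K) (update w a (b m * w a))) := by
      rw [Finset.sum_mul, Finset.sum_mul]
      refine Finset.sum_congr rfl fun m _ => ?_
      rw [← iota_mul_purePacket p (fun _ : I => K) a (b m) w, ← iota_star_mul_eq_smul p K star hV]
      ring
    have h1 : ∀ m, update w a (b m * w a) star = w star := fun m => update_of_ne (Ne.symm hastar) _ _
    have h2 : ∀ m, ∏ i ∈ s, update w a (b m * w a) i = ∏ i ∈ s, w i := fun m =>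
      Finset.prod_congr rfl fun i hi => update_of_ne (ne_of_mem_of_not_mem hi ha) _ _
    have hsd : (Finset.univ.erase star) \ s = insert a ((Finset.univ.erase star) \ insert a s) := by
      ext i
      simp only [Finset.mem_sdiff, Finset.mem_insert, Finset.mem_erase, Finset.mem_univ, and_true]
      constructor
      · rintro ⟨hi, hi'⟩
        by_cases hia : i = a
        · exact Or.inl hia
        · exact Or.inr ⟨hi, fun h => h.elim hia hi'⟩
      · rintro (rfl | ⟨hi, hi'⟩)
        · exact ⟨hastar, ha⟩
        · exact ⟨hi, fun h => hi' (Or.inr h)⟩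
    have ha' : a ∉ (Finset.univ.erase star) \ insert a s := by simp
    have h3 : ∀ m, ∏ i ∈ (Finset.univ.erase star) \ s, Algebra.trace ℚ_[p] K (update w a (b m * w a) i) =
        Algebra.trace ℚ_[p] K (w a * b m) * R := by
      intro m
      rw [hsd, Finset.prod_insert ha', update_self, mul_comm (b m)]
      refine congrArg _ (Finset.prod_congr rfl fun i hi => ?_)
      rw [update_of_ne (ne_of_mem_of_not_mem hi ha')]
    have hterm : ∀ m, Algebra.trace K (PacketAlgebra p (fun _ : I => K))
          (d m • (P * purePacket p (fun _ : I => K) (update w a (b m * w a)))) =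
        (Algebra.trace ℚ_[p] K (w a * b m) • d m) * (w star * (∏ i ∈ s, w i) * algebraMap ℚ_[p] K R) := by
      intro m
      rw [LinearMap.map_smul, ih hs' _, h1, h2, h3, map_mul, smul_eq_mul, Algebra.smul_def]
      ring
    rw [hexp, map_sum, Finset.sum_congr rfl (fun m _ => hterm m), ← Finset.sum_mul,
      dualPair_sum_trace_mul_smul b d hbd (w a), Finset.prod_insert ha]
    ring

include hV hbd in
/-- **`Tr_{V/k_*}(e · ⊗_i w_i) = ∏_i w_i`** for the full diagonal idempotent `e = ∏_{i≠*} E_i`.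
[claim: Mochizuki2012, status: disputed] -/
theorem relTrace_diag_mul_purePacket (w : I → K) :
    Algebra.trace K (PacketAlgebra p (fun _ : I => K))
        ((∏ i ∈ Finset.univ.erase star,
            ∑ m, iota p (fun _ : I => K) star (d m) * iota p (fun _ : I => K) i (b m)) *
          purePacket p (fun _ : I => K) w) = ∏ i, w i := by
  rw [relTrace_prod_diagE_mul_purePacket p K star hV b d hbd _ subset_rfl w, Finset.sdiff_self,
    Finset.prod_empty, map_one, mul_one, Finset.mul_prod_erase _ _ (Finset.mem_univ star)]

/-! ## The functional `y ↦ Tr_{V/k_*}((1 ⊗ ⊗_{i≠*} c)·y)` is integral on `R_I` -/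

include hV in
/-- If `Tr_{K/ℚ_p}(c·𝒪_K) ⊆ ℤ_p`, then `Tr_{V/k_*}((⊗_i c'_i)·y) ∈ 𝒪_K` for every `y ∈ R_I`, where
`c'_* = 1`, `c'_i = c` (`i ≠ *`). [claim: Mochizuki2012, status: disputed] -/
theorem norm_relTrace_mul_le_one_of_mem_integerPacket {c : K}
    (hc : ∀ v : K, ‖v‖ ≤ 1 → ‖Algebra.trace ℚ_[p] K (c * v)‖ ≤ 1)
    {y : PacketAlgebra p (fun _ : I => K)} (hy : y ∈ integerPacket p (fun _ : I => K)) :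
    ‖Algebra.trace K (PacketAlgebra p (fun _ : I => K))
        (purePacket p (fun _ : I => K) (update (fun _ => c) star 1) * y)‖ ≤ 1 := by
  refine integerPacket_induction p (fun _ : I => K)
    (C := fun y => ‖Algebra.trace K (PacketAlgebra p (fun _ : I => K))
        (purePacket p (fun _ : I => K) (update (fun _ => c) star 1) * y)‖ ≤ 1)
    (fun a ha => ?_) ?_ (fun u v hu hv => ?_) (fun u hu => ?_) hy
  · rw [purePacket_mul, relTrace_purePacket p (fun _ : I => K) star hV, Pi.mul_apply, update_self,
      one_mul, norm_mul, norm_algebraMap', norm_prod]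
    refine mul_le_one₀ (ha star) (Finset.prod_nonneg fun _ _ => norm_nonneg _)
      (Finset.prod_le_one (fun _ _ => norm_nonneg _) fun i hi => ?_)
    rw [Pi.mul_apply, update_of_ne (Finset.ne_of_mem_erase hi)]
    exact hc _ (ha i)
  · show ‖_‖ ≤ 1
    rw [mul_zero, map_zero, norm_zero]; exact zero_le_one
  · show ‖_‖ ≤ 1
    rw [mul_add, map_add]; exact (IsUltrametricDist.norm_add_le_max _ _).trans (max_le hu hv)
  · show ‖_‖ ≤ 1
    rw [mul_neg, map_neg, norm_neg]; exact hu

end Diagonal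

/-! ## Sharpness of the exponent of Prop. 1.1 -/

section Sharp

variable (p : ℕ) [Fact p.Prime]
variable {I : Type} [Fintype I] [DecidableEq I]
variable (K : Type) [NontriviallyNormedField K] [NormedAlgebra ℚ_[p] K] [IsUltrametricDist K]
  [ProperSpace K]

/-- **Sharpness of [IUTchIV] Prop. 1.1, trace-dual form.**  If the pure tensor `⊗_i x_i` multiplies
`(R_I)^∼` into `R_I` (all factors `k_i = K`), then `‖(∏_i x_i)·c^{|I|−1}‖ ≤ 1` for every `c` with
`Tr_{K/ℚ_p}(c·𝒪_K) ⊆ ℤ_p`. [claim: Mochizuki2012, status: disputed] -/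
theorem norm_prod_mul_pow_le_one_of_smul_normalizedPacket_subset (x : I → K)
    (hx : ∀ y ∈ normalizedPacket p (fun _ : I => K),
      purePacket p (fun _ : I => K) x * y ∈ integerPacket p (fun _ : I => K))
    {c : K} (hc : ∀ v : K, ‖v‖ ≤ 1 → ‖Algebra.trace ℚ_[p] K (c * v)‖ ≤ 1) :
    ‖(∏ i, x i) * c ^ (Fintype.card I - 1)‖ ≤ 1 := by
  classical
  rcases isEmpty_or_nonempty I with hI | hI
  · rw [Finset.univ_eq_empty, Finset.prod_empty, Fintype.card_eq_zero, Nat.zero_sub, pow_zero, mul_one,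
      norm_one]
  obtain ⟨star⟩ := id hI
  haveI := finiteDimensional p K
  letI : Algebra K (PacketAlgebra p (fun _ : I => K)) := (iota p (fun _ : I => K) star).toRingHom.toAlgebra
  have hV : ∀ a : K, algebraMap K (PacketAlgebra p (fun _ : I => K)) a = iota p (fun _ : I => K) star a :=
    fun _ => rfl
  obtain ⟨d, hbd⟩ := exists_traceDual_basis (p := p) (Module.finBasis ℚ_[p] K)
  set b : Basis (Fin (finrank ℚ_[p] K)) ℚ_[p] K := Module.finBasis ℚ_[p] K with hb
  -- the diagonal idempotent lies in `(R_I)^∼`, so `(⊗ x)·e ∈ R_I`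
  set e := ∏ i ∈ Finset.univ.erase star,
    ∑ m, iota p (fun _ : I => K) star (d m) * iota p (fun _ : I => K) i (b m) with he
  have he_mem : e ∈ normalizedPacket p (fun _ : I => K) :=
    mem_normalizedPacket_of_isIdempotentElem p K (isIdempotentElem_prod_diagE p K star b d hbd _)
  have hy := hx e he_mem
  have h := norm_relTrace_mul_le_one_of_mem_integerPacket p K star hV hc hy
  rw [← mul_assoc, purePacket_mul, mul_comm _ e, he,
    relTrace_diag_mul_purePacket p K star hV b d hbd] at h
  -- `∏_i (c'·x)_i = (∏_i x_i) · c^{|I|-1}`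
  have hc' : ∏ i, update (fun _ : I => c) star 1 i = c ^ (Fintype.card I - 1) := by
    rw [← Finset.mul_prod_erase _ _ (Finset.mem_univ star), update_self, one_mul,
      Finset.prod_congr rfl (fun i hi => update_of_ne (Finset.ne_of_mem_erase hi) (1 : K) (fun _ : I => c)),
      Finset.prod_const, Finset.card_erase_of_mem (Finset.mem_univ star), Finset.card_univ]
  have hprod : ∏ i, (update (fun _ : I => c) star 1 * x) i = (∏ i, x i) * c ^ (Fintype.card I - 1) := by
    simp only [Pi.mul_apply, Finset.prod_mul_distrib, hc', mul_comm]
  rwa [hprod] at h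

/-- The inverse of a generator `δ` of the different is in the trace dual of `𝒪_K`:
`Tr_{K/ℚ_p}(δ⁻¹·𝒪_K) ⊆ ℤ_p` (Mathlib `coeIdeal_differentIdeal`: the dual of `𝒪_K` is `𝔇⁻¹ = δ⁻¹𝒪_K`).
[claim: Mochizuki2012, status: disputed] -/
theorem norm_trace_generator_inv_mul_le_one {δ : Valued.integer K} (hδ : different p K = Ideal.span {δ})
    (v : K) (hv : ‖v‖ ≤ 1) : ‖Algebra.trace ℚ_[p] K ((δ : K)⁻¹ * v)‖ ≤ 1 := by
  classical
  haveI := finiteDimensional p K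
  have h10 : (1 : FractionalIdeal (Valued.integer K)⁰ K) ≠ 0 := one_ne_zero
  have hdual : FractionalIdeal.dual ℤ_[p] ℚ_[p] (1 : FractionalIdeal (Valued.integer K)⁰ K) =
      FractionalIdeal.spanSingleton (Valued.integer K)⁰ ((δ : K)⁻¹) := by
    have h := coeIdeal_differentIdeal ℤ_[p] ℚ_[p] K (Valued.integer K)
    rw [← different_eq, hδ, FractionalIdeal.coeIdeal_span_singleton] at h
    rw [← inv_inv (FractionalIdeal.dual ℤ_[p] ℚ_[p] _), ← h, FractionalIdeal.spanSingleton_inv]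
    rfl
  have hmem : (δ : K)⁻¹ ∈ FractionalIdeal.dual ℤ_[p] ℚ_[p] (1 : FractionalIdeal (Valued.integer K)⁰ K) := by
    rw [hdual]; exact FractionalIdeal.mem_spanSingleton_self _ _
  rw [FractionalIdeal.mem_dual h10] at hmem
  have hv' : v ∈ (1 : FractionalIdeal (Valued.integer K)⁰ K) :=
    (FractionalIdeal.mem_one_iff (S := (Valued.integer K)⁰)).mpr ⟨⟨v, hv⟩, rfl⟩
  obtain ⟨r, hr⟩ := hmem v hv'
  rw [Algebra.traceForm_apply] at hr
  rw [← hr, PadicInt.algebraMap_apply, PadicInt.padic_norm_e_of_padicInt]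
  exact PadicInt.norm_le_one r

/-- **Sharpness of the exponent `d_{I*}` of [IUTchIV] Prop. 1.1** (equal factors `k_i = K`): if
`(⊗_i x_i)·(R_I)^∼ ⊆ R_I` then `∏_i ‖x_i‖ ≤ ‖δ‖^{|I|−1} = p^{−(|I|−1)·d_K}` for any generator `δ` of
`𝔇_{K/ℚ_p}` — the exponent `Σ_{i≠*} d_i = (|I|−1)·d_K` of `purePacket_mul_mem_integerPacket` cannot be
lowered. [claim: Mochizuki2012, status: disputed] -/
theorem prod_norm_le_of_smul_normalizedPacket_subset (x : I → K)
    (hx : ∀ y ∈ normalizedPacket p (fun _ : I => K),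
      purePacket p (fun _ : I => K) x * y ∈ integerPacket p (fun _ : I => K))
    {δ : Valued.integer K} (hδ : different p K = Ideal.span {δ}) :
    ∏ i, ‖x i‖ ≤ (p : ℝ) ^ (-((Fintype.card I - 1 : ℕ) * differentOrd p K)) := by
  have hδ0 : (δ : K) ≠ 0 := by exact_mod_cast generator_ne_zero p K hδ
  have h := norm_prod_mul_pow_le_one_of_smul_normalizedPacket_subset p K x hx
    (norm_trace_generator_inv_mul_le_one p K hδ)
  rw [norm_mul, norm_pow, norm_inv, norm_prod] at h
  have hδn : 0 < ‖(δ : K)‖ := norm_pos_iff.mpr hδ0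
  have h' : ∏ i, ‖x i‖ ≤ ‖(δ : K)‖ ^ (Fintype.card I - 1) := by
    rw [inv_pow, ← div_eq_mul_inv, div_le_one (pow_pos hδn _)] at h
    exact h
  refine h'.trans_eq ?_
  rw [norm_eq_rpow_neg_differentOrd p K hδ (generator_ne_zero p K hδ), ← Real.rpow_natCast,
    ← Real.rpow_mul (by exact_mod_cast (Fact.out : p.Prime).pos.le)]
  congr 1
  ring

end Sharp

end Literature.IUT.LogVolume

end
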